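import Summits.CriticalPhenomena.SAWScalingLimit.Theorems.EventualTight.Negative.Snake1Domain

/-!
# `EventualTight` — negative knowledge: boundary regularity is load-bearing (the dyadic snake)

Part 2: lattice bookkeeping at mesh `δ` — reachability inside the mesh vertex graph along rows and columns of convex boxes, and the DESCENT from any resolved column/connector (`16 δ < r k`) to the base point `v₀ δ ∈ col 0`.

Support files for the crux `stmt-CriticalPhenomena-1372`
(`Summit.CriticalPhenomena.SAWScalingLimit.Theses.SAWRenewalTightness.EventualTight`; refuter `cdisprove`,
standing adversary; indexed work file
`Summits/CriticalPhenomena/SAWScalingLimit/Cruxes/EventualTight/Disproof.lean`, §5). The four parts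
`Snake1Domain … Snake4Forcing` prove: over bounded open CONNECTED sets with two distinct marked FRONTIER
points (all the fields of `DobrushinDomain` except the Jordan boundary loop), the statement of the crux
is FALSE — so any proof of `EventualTight` must use the boundary loop (local connectivity of `∂Ω` at the
marked points). Everything proved, standard axioms. [folklore]
-/

noncomputable section

open MeasureTheory Filter Topology Set Metric Complex
open Literature.Probability.RandomPlanarGeometry Literature.Probability.RandomPlanarGeometry.SAW
  Literature.Probability.LatticeModels
open scoped ENNReal NNReal unitInterval

namespace Summit.CriticalPhenomena.SAWScalingLimit.Theorems.EventualTight.Negative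

open Summit.CriticalPhenomena.SAWScalingLimit.Theorems.ShellCrossingBound.Negative
  (exists_forall_not_hasTraversals_of_isCompact)
open Summit.CriticalPhenomena.SAWScalingLimit.Theorems.ShellCrossingBound.Negative.Forcing
  (meshPoint_vec vec_add_single_zero vec_add_single_one eq_vec exists_chain chain_lt
    range_toCurve_subset toCurve_apply_one isProbabilityMeasure_law abs_im_sub_le_dist)

namespace Snake

/-! ### Lattice bookkeeping at mesh `δ` -/

/-- Snake bookkeeping (`vec_mem_iff`). [folklore] -/
theorem vec_mem_iff {δ : ℝ} {i j : ℤ} :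
    (![i, j] : Site 2) ∈ meshVertices Ω δ ↔ (⟨δ * i, δ * j⟩ : ℂ) ∈ Ω := by
  rw [mem_meshVertices_iff, meshPoint_vec]

/-- Reachability of two lattice sites inside the mesh vertex graph of the snake. [folklore] -/
def Reach (δ : ℝ) (u v : Site 2) : Prop :=
  ∃ (hu : u ∈ meshVertices Ω δ) (hv : v ∈ meshVertices Ω δ),
    (meshVertexGraph Ω δ).Reachable ⟨u, hu⟩ ⟨v, hv⟩

/-- Snake bookkeeping (`Reach.fst`). [folklore] -/
theorem Reach.fst {δ : ℝ} {u v : Site 2} (h : Reach δ u v) : u ∈ meshVertices Ω δ := h.1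

/-- Snake bookkeeping (`Reach.snd`). [folklore] -/
theorem Reach.snd {δ : ℝ} {u v : Site 2} (h : Reach δ u v) : v ∈ meshVertices Ω δ := h.2.1

/-- Snake bookkeeping (`Reach.rfl'`). [folklore] -/
theorem Reach.rfl' {δ : ℝ} {u : Site 2} (hu : u ∈ meshVertices Ω δ) : Reach δ u u :=
  ⟨hu, hu, SimpleGraph.Reachable.refl _⟩

/-- Snake bookkeeping (`Reach.symm`). [folklore] -/
theorem Reach.symm {δ : ℝ} {u v : Site 2} (h : Reach δ u v) : Reach δ v u := by
  obtain ⟨hu, hv, h⟩ := h; exact ⟨hv, hu, h.symm⟩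

/-- Snake bookkeeping (`Reach.trans`). [folklore] -/
theorem Reach.trans {δ : ℝ} {u v w : Site 2} (h₁ : Reach δ u v) (h₂ : Reach δ v w) :
    Reach δ u w := by
  obtain ⟨hu, hv, h₁⟩ := h₁; obtain ⟨hv', hw, h₂⟩ := h₂; exact ⟨hu, hw, h₁.trans h₂⟩

/-- Two `ℤ²`-neighbours whose mesh points lie in a common convex part of the snake are joined. [folklore] -/
theorem reach_of_adj_of_convex {δ : ℝ} {P : Set ℂ} (hP : Convex ℝ P) (hPΩ : P ⊆ Ω) {u v : Site 2}
    (huv : (zdGraph 2).Adj u v) (hu : meshPoint δ u ∈ P) (hv : meshPoint δ v ∈ P) : Reach δ u v := by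
  have hu' : u ∈ meshVertices Ω δ := hPΩ hu
  have hv' : v ∈ meshVertices Ω δ := hPΩ hv
  refine ⟨hu', hv', SimpleGraph.Adj.reachable ?_⟩
  simp only [SimpleGraph.comap_adj, Function.Embedding.subtype_apply]
  exact meshGraph_adj_iff.2 ⟨huv, ((hP.segment_subset hu hv).trans hPΩ).trans subset_closure⟩

/-- Horizontal run inside a convex box of the snake: `(i, j) ⇝ (i + n, j)`. [folklore] -/
theorem reach_row {δ : ℝ} (hδ : 0 < δ) {s t : Set ℝ} [s.OrdConnected] (hst : Convex ℝ (s ×ℂ t))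
    (hΩ : s ×ℂ t ⊆ Ω) {i j : ℤ} {n : ℕ} (hi : δ * i ∈ s) (hin : δ * (i + n) ∈ s) (hj : δ * j ∈ t) :
    Reach δ ![i, j] ![i + n, j] := by
  have hmem : ∀ m : ℕ, m ≤ n → (⟨δ * (i + m), δ * j⟩ : ℂ) ∈ s ×ℂ t := fun m hm =>
    ⟨Set.OrdConnected.out ‹_› hi hin ⟨by push_cast; nlinarith, by
      have : (m : ℝ) ≤ n := by exact_mod_cast hm
      nlinarith⟩, hj⟩
  have key : ∀ m : ℕ, m ≤ n → Reach δ ![i, j] ![i + m, j] := by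
    intro m
    induction m with
    | zero =>
      intro _
      have h0 := hmem 0 (Nat.zero_le _)
      simp only [Nat.cast_zero, add_zero] at h0 ⊢
      exact Reach.rfl' (vec_mem_iff.2 (hΩ h0))
    | succ m ih =>
      intro hm
      refine (ih (Nat.le_of_succ_le hm)).trans (reach_of_adj_of_convex hst hΩ ?_ ?_ ?_)
      · rw [zdGraph_adj_iff]
        refine ⟨0, Or.inl ?_⟩
        rw [vec_add_single_zero]; push_cast; ring_nf
      · rw [meshPoint_vec]; exact_mod_cast hmem m (Nat.le_of_succ_le hm)
      · rw [meshPoint_vec]; exact_mod_cast hmem (m + 1) hm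
  exact key n le_rfl

/-- Vertical run inside a convex box of the snake: `(i, j) ⇝ (i, j + n)`. [folklore] -/
theorem reach_colrun {δ : ℝ} (hδ : 0 < δ) {s t : Set ℝ} [t.OrdConnected] (hst : Convex ℝ (s ×ℂ t))
    (hΩ : s ×ℂ t ⊆ Ω) {i j : ℤ} {n : ℕ} (hi : δ * i ∈ s) (hj : δ * j ∈ t) (hjn : δ * (j + n) ∈ t) :
    Reach δ ![i, j] ![i, j + n] := by
  have hmem : ∀ m : ℕ, m ≤ n → (⟨δ * i, δ * (j + m)⟩ : ℂ) ∈ s ×ℂ t := fun m hm =>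
    ⟨hi, Set.OrdConnected.out ‹_› hj hjn ⟨by push_cast; nlinarith, by
      have : (m : ℝ) ≤ n := by exact_mod_cast hm
      nlinarith⟩⟩
  have key : ∀ m : ℕ, m ≤ n → Reach δ ![i, j] ![i, j + m] := by
    intro m
    induction m with
    | zero =>
      intro _
      have h0 := hmem 0 (Nat.zero_le _)
      simp only [Nat.cast_zero, add_zero] at h0 ⊢
      exact Reach.rfl' (vec_mem_iff.2 (hΩ h0))
    | succ m ih =>
      intro hm
      refine (ih (Nat.le_of_succ_le hm)).trans (reach_of_adj_of_convex hst hΩ ?_ ?_ ?_)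
      · rw [zdGraph_adj_iff]
        refine ⟨1, Or.inl ?_⟩
        rw [vec_add_single_one]; push_cast; ring_nf
      · rw [meshPoint_vec]; exact_mod_cast hmem m (Nat.le_of_succ_le hm)
      · rw [meshPoint_vec]; exact_mod_cast hmem (m + 1) hm
  exact key n le_rfl

/-- Horizontal run, either direction. [folklore] -/
theorem reach_row' {δ : ℝ} (hδ : 0 < δ) {s t : Set ℝ} [s.OrdConnected] (hst : Convex ℝ (s ×ℂ t))
    (hΩ : s ×ℂ t ⊆ Ω) {i i' j : ℤ} (hi : δ * i ∈ s) (hi' : δ * i' ∈ s) (hj : δ * j ∈ t) :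
    Reach δ ![i, j] ![i', j] := by
  rcases le_total i i' with h | h
  · obtain ⟨n, rfl⟩ := Int.le.dest h
    exact reach_row hδ hst hΩ hi (by exact_mod_cast hi') hj
  · obtain ⟨n, rfl⟩ := Int.le.dest h
    exact (reach_row hδ hst hΩ hi' (by exact_mod_cast hi) hj).symm

/-- Vertical run, either direction. [folklore] -/
theorem reach_colrun' {δ : ℝ} (hδ : 0 < δ) {s t : Set ℝ} [t.OrdConnected] (hst : Convex ℝ (s ×ℂ t))
    (hΩ : s ×ℂ t ⊆ Ω) {i j j' : ℤ} (hi : δ * i ∈ s) (hj : δ * j ∈ t) (hj' : δ * j' ∈ t) :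
    Reach δ ![i, j] ![i, j'] := by
  rcases le_total j j' with h | h
  · obtain ⟨n, rfl⟩ := Int.le.dest h
    exact reach_colrun hδ hst hΩ hi hj (by exact_mod_cast hj')
  · obtain ⟨n, rfl⟩ := Int.le.dest h
    exact (reach_colrun hδ hst hΩ hi hj' (by exact_mod_cast hj)).symm

/-! ### Resolved levels and the descent to the base point -/

/-- The first lattice abscissa right of `x`: `⌊x/δ⌋ + 1`. [folklore] -/
def nxt (δ x : ℝ) : ℤ := ⌊x / δ⌋ + 1

/-- Snake bookkeeping (`nxt_bounds`). [folklore] -/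
theorem nxt_bounds {δ : ℝ} (hδ : 0 < δ) (x : ℝ) : x < δ * nxt δ x ∧ δ * nxt δ x ≤ x + δ := by
  unfold nxt
  have h1 := Int.floor_le (x / δ)
  have h2 := Int.lt_floor_add_one (x / δ)
  push_cast
  constructor
  · have := mul_lt_mul_of_pos_left h2 hδ
    rwa [mul_div_cancel₀ _ hδ.ne'] at this
  · have := mul_le_mul_of_nonneg_left h1 hδ.le
    rw [mul_div_cancel₀ _ hδ.ne'] at this
    linarith

/-- The lattice row of the window of level `k`: row `1` at the bottom, `⌊3/(4δ)⌋ + 1` at the top. [folklore] -/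
def jw (δ : ℝ) (k : ℕ) : ℤ := if Even k then 1 else nxt δ (3 / 4)

/-- Snake bookkeeping (`jw_mem_win`). [folklore] -/
theorem jw_mem_win {δ : ℝ} (hδ : 0 < δ) (hδ4 : δ < 1 / 4) (k : ℕ) : δ * (jw δ k) ∈ win k := by
  unfold jw win
  split_ifs with h
  · push_cast; constructor <;> linarith
  · obtain ⟨h1, h2⟩ := nxt_bounds hδ (3 / 4)
    exact ⟨h1, by linarith⟩

/-- Snake bookkeeping (`jw_mem_Ioo`). [folklore] -/
theorem jw_mem_Ioo {δ : ℝ} (hδ : 0 < δ) (hδ4 : δ < 1 / 4) (k : ℕ) : δ * (jw δ k) ∈ Ioo (0:ℝ) 1 :=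
  win_subset k (jw_mem_win hδ hδ4 k)

/-- Snake bookkeeping (`one_mem_Ioo`). [folklore] -/
theorem one_mem_Ioo {δ : ℝ} (hδ : 0 < δ) (hδ4 : δ < 1 / 4) : δ * ((1 : ℤ) : ℝ) ∈ Ioo (0:ℝ) 1 := by
  push_cast; constructor <;> linarith

/-- The base column abscissa `I δ + 1 = ⌊(5/8)/δ⌋ + 1`, the first lattice abscissa in `col 0`. [folklore] -/
def ib (δ : ℝ) : ℤ := nxt δ (5 / 8)

/-- The base point `v₀ δ = (ib δ, 1) ∈ col 0`. [folklore] -/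
def v₀ (δ : ℝ) : Site 2 := ![ib δ, 1]

/-- Snake bookkeeping (`ib_mem`). [folklore] -/
theorem ib_mem {δ : ℝ} (hδ : 0 < δ) (hδs : δ < 3 / 8) : δ * (ib δ) ∈ Ioo (l 0) (r 0) := by
  obtain ⟨h1, h2⟩ := nxt_bounds hδ (5 / 8)
  unfold ib l; rw [r_zero]
  exact ⟨by linarith, by linarith⟩

/-- Snake bookkeeping (`meshPoint_v₀_mem`). [folklore] -/
theorem meshPoint_v₀_mem {δ : ℝ} (hδ : 0 < δ) (hδs : δ < 1 / 4) : meshPoint δ (v₀ δ) ∈ col 0 := by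
  rw [v₀, meshPoint_vec]
  exact ⟨ib_mem hδ (by linarith), one_mem_Ioo hδ hδs⟩

/-- From any lattice point of a resolved column `col k` (`16 δ < r k`) to the base point. [folklore] -/
theorem reach_v₀_of_col {δ : ℝ} (hδ : 0 < δ) (hδs : δ < 1 / 64) :
    ∀ (k : ℕ), 16 * δ < r k → ∀ (i j : ℤ), (⟨δ * i, δ * j⟩ : ℂ) ∈ col k → Reach δ ![i, j] (v₀ δ) := by
  intro k
  induction k with
  | zero =>
    intro _ i j hij
    obtain ⟨hi, hj⟩ := hij
    have h1 : Reach δ ![i, j] ![i, 1] :=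
      reach_colrun' hδ (convex_col 0) (col_subset_Ω 0) hi hj (one_mem_Ioo hδ (by linarith))
    refine h1.trans ?_
    exact reach_row' hδ (convex_col 0) (col_subset_Ω 0) hi (ib_mem hδ (by linarith))
      (one_mem_Ioo hδ (by linarith))
  | succ k ih =>
    intro hres i j hij
    obtain ⟨hi, hj⟩ := hij
    have hresk : 16 * δ < r k := hres.trans (r_lt_of_lt (Nat.lt_succ_self k))
    have hδ4 : δ < 1 / 4 := by linarith
    -- up/down the column to the window row of level `k`
    have h1 : Reach δ ![i, j] ![i, jw δ k] :=
      reach_colrun' hδ (convex_col (k + 1)) (col_subset_Ω (k + 1)) hi hj (jw_mem_Ioo hδ hδ4 k)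
    -- along the connector `conn k` to the first abscissa of `col k`
    obtain ⟨hn1, hn2⟩ := nxt_bounds hδ (l k)
    have hwidth : l k + δ < r k := by unfold l; linarith
    have hi2 : δ * (nxt δ (l k)) ∈ Ioo (l (k + 1)) (r k) :=
      ⟨(l_antitone (Nat.le_succ k)).trans_lt hn1, by linarith⟩
    have hi1 : δ * i ∈ Ioo (l (k + 1)) (r k) := ⟨hi.1, hi.2.trans (r_lt_of_lt (Nat.lt_succ_self k))⟩
    have h2 : Reach δ ![i, jw δ k] ![nxt δ (l k), jw δ k] :=
      reach_row' hδ (convex_conn k) (conn_subset_Ω k) hi1 hi2 (jw_mem_win hδ hδ4 k)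
    -- and now we are in `col k`
    have h3 : (⟨δ * (nxt δ (l k)), δ * (jw δ k)⟩ : ℂ) ∈ col k :=
      ⟨⟨hn1, by linarith⟩, jw_mem_Ioo hδ hδ4 k⟩
    exact (h1.trans h2).trans (ih hresk _ _ h3)

/-- From any lattice point of a resolved connector `conn k` (`16 δ < r k`) to the base point. [folklore] -/
theorem reach_v₀_of_conn {δ : ℝ} (hδ : 0 < δ) (hδs : δ < 1 / 64) {k : ℕ} (hres : 16 * δ < r k)
    {i j : ℤ} (hij : (⟨δ * i, δ * j⟩ : ℂ) ∈ conn k) : Reach δ ![i, j] (v₀ δ) := by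
  obtain ⟨hi, hj⟩ := hij
  obtain ⟨hn1, hn2⟩ := nxt_bounds hδ (l k)
  have hwidth : l k + δ < r k := by unfold l; linarith
  have hi2 : δ * (nxt δ (l k)) ∈ Ioo (l (k + 1)) (r k) :=
    ⟨(l_antitone (Nat.le_succ k)).trans_lt hn1, by linarith⟩
  have h1 : Reach δ ![i, j] ![nxt δ (l k), j] :=
    reach_row' hδ (convex_conn k) (conn_subset_Ω k) hi hi2 hj
  have h2 : (⟨δ * (nxt δ (l k)), δ * j⟩ : ℂ) ∈ col k := ⟨⟨hn1, by linarith⟩, win_subset k hj⟩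
  exact h1.trans (reach_v₀_of_col hδ hδs k hres _ _ h2)

end Snake

end Summit.CriticalPhenomena.SAWScalingLimit.Theorems.EventualTight.Negative

end
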